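import Literature.NumberTheory.Automorphic.UnitaryGroupAdelicOrbitalMeasure
import HarnessLib

/-!
# Orbital measures at CENTRAL elements: the orbit space is a point, the Dirac mass is the invariant measure; adelic orbital
# measure families of `U(H)` admissible on the regular AND the central classes
(Rogawski, *Automorphic representations of unitary groups in three variables* (1990), §14.5 p. 237 (print): the O-expansion of the
anisotropic `G′` runs over all semisimple classes «modulo `Z`»; the scalar classes `ζ·1`, `ζ ∈ U(1)`, are among them)

Topic `NumberTheory/Automorphic`; namespace `Literature.NumberTheory.Automorphic` (§1 generic) and `….UnitaryGroup` (§2); THEOREMS ONLY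
(no def, no instance, no named fact, no `sorry`).  Sequel of ★ O1 `UnitaryGroupAdelicOrbitalMeasure` (regular classes); the first entry of
the «singular classes» bank (PLAN-T1 (g2) R-g2-3): the CENTRAL ones cost nothing.

* §1 (any topological group `G`, `γ ∈ G` with `∀ g, g γ = γ g`): `centralizer_eq_top_of_forall_comm`, `subsingleton_quotient_centralizer_of_forall_comm`
  (the orbit space `G ⧸ C(γ)` is ONE point), **`exists_smulInvariantMeasure_quotient_centralizer_of_forall_comm_top`**: the Dirac mass at the
  point is a `G`-invariant measure, finite on compact sets, `≠ 0`; the orbital integral against it is `F(γ)` (`orbitalIntegral_dirac_of_forall_comm`).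
* §2 (`U(H)`, `N ≥ 3`, `H` hermitian, `det H ≠ 0`): **`exists_adelicOrbitalMeasureFamily_of_isRegularElt_or_central`** — a rational-class-indexed
  ★ `AdelicOrbitalMeasureFamily` whose member is non-zero, invariant and finite on compact sets at every class `[γ]` that is REGULAR (★ O1) or
  whose adelic representative `toAdelic γ_c` is CENTRAL in `U(H)(𝔸)`.
Still banked: the singular NON-central semisimple classes (`{α, α, β}`: `U(2) × U(1)`-type centralisers; needs «reductive ⇒ unimodular»).

## References
* J. D. Rogawski, *Automorphic Representations of Unitary Groups in Three Variables*, Ann. of Math. Stud. 123 (1990), §14.5 p. 237 [Rogawski1990].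
* A. Deitmar, S. Echterhoff, *Principles of Harmonic Analysis*, 2nd ed. (2014), Thm. 1.5.3 [DeitmarEchterhoff2014].
-/

noncomputable section

open MeasureTheory Measure Set Filter Topology NumberField CompactlySupported
open Literature.MeasureTheory.Group
open scoped ENNReal NNReal Pointwise

namespace Literature.NumberTheory.Automorphic

/-! ## §1 Central elements of a topological group: the orbit space is a point -/

section Central

variable {G : Type*} [Group G] {γ : G}

/-- The centraliser of an element commuting with everything is the whole group. [cite: DeitmarEchterhoff2014, Thm. 1.5.3] -/
theorem centralizer_eq_top_of_forall_comm (hγ : ∀ g : G, g * γ = γ * g) : Subgroup.centralizer ({γ} : Set G) = ⊤ :=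
  top_unique fun g _ => Subgroup.mem_centralizer_singleton_iff.mpr (hγ g)

/-- **The orbit space `G ⧸ C(γ)` of a central element is one point.** [cite: DeitmarEchterhoff2014, Thm. 1.5.3] -/
theorem subsingleton_quotient_centralizer_of_forall_comm (hγ : ∀ g : G, g * γ = γ * g) :
    Subsingleton (G ⧸ Subgroup.centralizer ({γ} : Set G)) := by
  refine ⟨fun x y => ?_⟩
  induction x using QuotientGroup.induction_on with
  | H a =>
    induction y using QuotientGroup.induction_on with
    | H b =>
      refine QuotientGroup.eq.mpr ?_
      rw [centralizer_eq_top_of_forall_comm hγ]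
      exact Subgroup.mem_top _

variable [TopologicalSpace G] [MeasurableSpace (G ⧸ Subgroup.centralizer ({γ} : Set G))]

/-- **The Dirac mass on the one-point orbit space of a central element is a non-zero `G`-invariant measure finite on compact sets.**
[cite: DeitmarEchterhoff2014, Thm. 1.5.3] -/
theorem exists_smulInvariantMeasure_quotient_centralizer_of_forall_comm_top (hγ : ∀ g : G, g * γ = γ * g) :
    ∃ m : Measure (G ⧸ Subgroup.centralizer ({γ} : Set G)),
      SMulInvariantMeasure G (G ⧸ Subgroup.centralizer ({γ} : Set G)) m ∧ IsFiniteMeasureOnCompacts m ∧ m ≠ 0 := by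
  haveI := subsingleton_quotient_centralizer_of_forall_comm hγ
  refine ⟨Measure.dirac (QuotientGroup.mk 1), ⟨fun c s _ => ?_⟩, inferInstance, ?_⟩
  · -- every translate of a set in a one-point space is the set itself
    have hs : (fun x : G ⧸ Subgroup.centralizer ({γ} : Set G) => c • x) ⁻¹' s = s := by
      ext x
      simp only [Set.mem_preimage, Subsingleton.elim (c • x) x]
    rw [hs]
  · intro h
    have h1 := congrArg (fun m : Measure (G ⧸ Subgroup.centralizer ({γ} : Set G)) => m Set.univ) h
    simp at h1

omit [TopologicalSpace G] in
/-- The orbital integral against the Dirac mass at the base point is the point value `F(γ)` (the central case: that Dirac mass is the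
invariant measure). [cite: DeitmarEchterhoff2014, Thm. 1.5.3] -/
theorem orbitalIntegral_dirac_of_forall_comm {E : Type*} [NormedAddCommGroup E] [NormedSpace ℝ E] [CompleteSpace E]
    [MeasurableSingletonClass (G ⧸ Subgroup.centralizer ({γ} : Set G))] (F : G → E) :
    orbitalIntegral γ F (Measure.dirac (QuotientGroup.mk 1)) = F γ := by
  rw [orbitalIntegral_eq_integral_descConj, integral_dirac, descConj_mk, one_mul, inv_one, mul_one]

end Central

/-! ## §2 `U(H)`: adelic orbital measures at the regular and at the central rational classes -/

namespace UnitaryGroup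

open Literature.NumberTheory.Rogawski1990

variable (L : Type) [Field L] [NumberField L] [IsCMField L] (N : ℕ) (H : Matrix (Fin N) (Fin N) L)
  [MeasurableSpace (cmDatum L N H).Adelic] [BorelSpace (cmDatum L N H).Adelic]
  [∀ g : (cmDatum L N H).Adelic,
    MeasurableSpace ((cmDatum L N H).Adelic ⧸ Subgroup.centralizer ({g} : Set (cmDatum L N H).Adelic))]
  [∀ g : (cmDatum L N H).Adelic,
    BorelSpace ((cmDatum L N H).Adelic ⧸ Subgroup.centralizer ({g} : Set (cmDatum L N H).Adelic))]

/-- **An adelic orbital measure family admissible on the REGULAR and on the CENTRAL classes** (`N ≥ 3`, `H` hermitian, `det H ≠ 0`):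
non-zero, `U(H)(𝔸)`-invariant, finite on compact sets at every class `[γ]` whose representative `γ_c = out [γ]` is regular semisimple
(★ O1) or has `toAdelic γ_c` central in `U(H)(𝔸_{L⁺})` (Dirac mass on the one-point orbit space). [cite: Rogawski1990, §14.5 p. 237] -/
theorem exists_adelicOrbitalMeasureFamily_of_isRegularElt_or_central (hN : 3 ≤ N) (hH : (H.map (cmConjRingHom L)).transpose = H)
    (hdet : H.det ≠ 0) :
    ∃ μ : AdelicOrbitalMeasureFamily L N H, ∀ c : ConjClasses (cmDatum L N H).Rational,
      (IsRegularElt ((Quotient.out c : (cmDatum L N H).Rational).val : GL (Fin N) L) ∨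
        ∀ g : (cmDatum L N H).Adelic, g * (cmDatum L N H).toAdelic (Quotient.out c) = (cmDatum L N H).toAdelic (Quotient.out c) * g) →
        SMulInvariantMeasure (cmDatum L N H).Adelic _ (μ c) ∧ IsFiniteMeasureOnCompacts (μ c) ∧ μ c ≠ 0 := by
  classical
  -- at each class: the regular construction if regular, else the Dirac construction if central, else `0`
  have key : ∀ c : ConjClasses (cmDatum L N H).Rational,
      (IsRegularElt ((Quotient.out c : (cmDatum L N H).Rational).val : GL (Fin N) L) ∨
        ∀ g : (cmDatum L N H).Adelic, g * (cmDatum L N H).toAdelic (Quotient.out c) = (cmDatum L N H).toAdelic (Quotient.out c) * g) →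
      ∃ m : Measure ((cmDatum L N H).Adelic ⧸
          Subgroup.centralizer ({(cmDatum L N H).toAdelic (Quotient.out c)} : Set (cmDatum L N H).Adelic)),
        SMulInvariantMeasure (cmDatum L N H).Adelic _ m ∧ IsFiniteMeasureOnCompacts m ∧ m ≠ 0 := by
    intro c hc
    by_cases hreg : IsRegularElt ((Quotient.out c : (cmDatum L N H).Rational).val : GL (Fin N) L)
    · exact exists_adelicOrbitalMeasure_of_isRegularElt L N H hN hH hdet (Quotient.out c) hreg
    · exact exists_smulInvariantMeasure_quotient_centralizer_of_forall_comm_top (hc.resolve_left hreg)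
  refine ⟨fun c => if h : (IsRegularElt ((Quotient.out c : (cmDatum L N H).Rational).val : GL (Fin N) L) ∨
      ∀ g : (cmDatum L N H).Adelic, g * (cmDatum L N H).toAdelic (Quotient.out c) = (cmDatum L N H).toAdelic (Quotient.out c) * g)
      then (key c h).choose else 0, fun c hc => ?_⟩
  simp only [dif_pos hc]
  exact (key c hc).choose_spec

end UnitaryGroup

end Literature.NumberTheory.Automorphic
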